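import Literature.NumberTheory.GaloisRepresentations.SubgroupKummerNormCoherentRoots
import HarnessLib

/-!
# Coset norms along a tower of subgroups: reindexing, transitivity, and equivariance under the ambient group

Topic `Literature/NumberTheory/GaloisRepresentations` (sequel of `SubgroupKummerMu`, `SubgroupKummerNormCoherentRoots`).  THEOREMS
ONLY (no definition, no named fact, no instance, no `sorry`).  Setting: a field `K`, `Γ_K` acting on the units of `K̄`, subgroups
`W ≤ V ≤ H ≤ Γ_K` with finite steps, sections `t` of the quotient maps, and the COSET NORMS `N_{H/V}(z) = ∏_{x ∈ H/V} t(x)·z` of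
`V`-fixed units (the field norms `N_{K̄^V/K̄^H}` written inside `K̄`; Serre, *Local Fields* X §3 b): «cor in degree 0 is the norm»).
* §1 `smul_eq_smul_of_quotient_eq`, ★ `prod_smul_eq_prod_smul_of_bijective` — the coset norm may be computed along ANY family of
  elements of `H` representing each class of `H/V` exactly once (reindexing; independence of the section is the special case).
* §2 ★ `prod_smul_prod_smul_eq` — TRANSITIVITY `N_{H/V}(N_{V/W}(z)) = N_{H/W}(z)` for `W ≤ V ≤ H` and a `W`-fixed unit `z`
  (the products `t₁(x)t₂(y)` represent `H/W` exactly once).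
* §3 ★ `smul_prod_smul_eq` — EQUIVARIANCE `g·N_{H/V}(z) = N_{H/V}(g·z)` for `g ∈ Γ_K` when `H` and `V` are normal in `Γ_K`
  (the conjugates `g t(x) g⁻¹` represent `H/V` exactly once; `g·z` is again `V`-fixed).
These are the bookkeeping identities behind «the norm-coherent elliptic units `(z_s)` of Kato §15.5 have norm-coherent coset norms in
every intermediate tower» used by the `𝒞₇` genus road (Rubin LNM 1716 §7, passage to `U_∞ = lim← U_n`).
## References
* J.-P. Serre, *Local Fields* (1979), X §3 b) (cor in degree 0 is the norm), VII §5. [Serre1979]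
* J. Neukirch, A. Schmidt, K. Wingberg, *Cohomology of Number Fields* (2008), I §5 (cor ∘ res, double cosets). [NeukirchSchmidtWingberg2008]
* K. Rubin, LNM 1716 (1999), §7. [Rubin1999]
-/

noncomputable section

namespace Literature.NumberTheory.GaloisRepresentations

open Field

variable {K : Type} [Field K]

/-! ## §1 Reindexing coset norms along bijective families of representatives -/

section Reindex

variable {V H : Subgroup (absoluteGaloisGroup K)}

/-- Two elements of `H` in the same class modulo `V` act in the same way on a `V`-fixed unit. [cite: Serre1979, X §3 b)] -/
theorem smul_eq_smul_of_quotient_eq {a b : H} (h : (a : H ⧸ V.subgroupOf H) = b) {z : (AlgebraicClosure K)ˣ}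
    (hz : ∀ σ : V, (σ : absoluteGaloisGroup K) • z = z) :
    (a : absoluteGaloisGroup K) • z = (b : absoluteGaloisGroup K) • z := by
  have hmem : a⁻¹ * b ∈ V.subgroupOf H := QuotientGroup.eq.mp h
  rw [Subgroup.mem_subgroupOf, Subgroup.coe_mul, Subgroup.coe_inv] at hmem
  have h1 := hz ⟨_, hmem⟩
  change (((a : H) : absoluteGaloisGroup K)⁻¹ * ((b : H) : absoluteGaloisGroup K)) • z = z at h1
  rw [mul_smul, inv_smul_eq_iff] at h1
  exact h1.symm

/-- ★ **Reindexing**: for a family `r : ι → H` representing every class of `H/V` exactly once and any section `t` of `H → H/V`,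
`∏ᵢ r(i)·z = ∏ₓ t(x)·z` for a `V`-fixed unit `z`. [cite: Serre1979, X §3 b)] [cite: NeukirchSchmidtWingberg2008, I §5] -/
theorem prod_smul_eq_prod_smul_of_bijective [Fintype (H ⧸ V.subgroupOf H)] {ι : Type*} [Fintype ι] (r : ι → H)
    (hr : Function.Bijective fun i ↦ (r i : H ⧸ V.subgroupOf H)) {t : H ⧸ V.subgroupOf H → H}
    (ht : ∀ x, (t x : H ⧸ V.subgroupOf H) = x) {z : (AlgebraicClosure K)ˣ} (hz : ∀ σ : V, (σ : absoluteGaloisGroup K) • z = z) :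
    ∏ i, ((r i : H) : absoluteGaloisGroup K) • z = ∏ x, ((t x : H) : absoluteGaloisGroup K) • z :=
  Fintype.prod_bijective _ hr (fun i ↦ ((r i : H) : absoluteGaloisGroup K) • z)
    (fun x ↦ ((t x : H) : absoluteGaloisGroup K) • z) fun i ↦ smul_eq_smul_of_quotient_eq (by rw [ht]) hz

end Reindex

/-! ## §2 Transitivity of coset norms -/

section Transitivity

variable {W V H : Subgroup (absoluteGaloisGroup K)} [Fintype (H ⧸ V.subgroupOf H)] [Fintype (V ⧸ W.subgroupOf V)]
  [Fintype (H ⧸ W.subgroupOf H)]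

omit [Fintype (H ⧸ V.subgroupOf H)] [Fintype (V ⧸ W.subgroupOf V)] [Fintype (H ⧸ W.subgroupOf H)] in
/-- The products `t₁(x)·t₂(y)` (`x ∈ H/V`, `y ∈ V/W`, sections `t₁`, `t₂`) lie in pairwise distinct classes of `H/W` (`W ≤ V`).
[cite: Serre1979, X §3 b)] -/
theorem injective_mul_section (hWV : W ≤ V) (hVH : V ≤ H) {t₁ : H ⧸ V.subgroupOf H → H}
    (ht₁ : ∀ x, (t₁ x : H ⧸ V.subgroupOf H) = x) {t₂ : V ⧸ W.subgroupOf V → V} (ht₂ : ∀ y, (t₂ y : V ⧸ W.subgroupOf V) = y) :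
    Function.Injective fun p : (H ⧸ V.subgroupOf H) × (V ⧸ W.subgroupOf V) ↦
      ((t₁ p.1 * ⟨((t₂ p.2 : V) : absoluteGaloisGroup K), hVH (t₂ p.2).2⟩ : H) : H ⧸ W.subgroupOf H) := by
  rintro ⟨x, y⟩ ⟨x', y'⟩ hxy
  have hmem := QuotientGroup.eq.mp hxy
  simp only [Subgroup.mem_subgroupOf, Subgroup.coe_mul, Subgroup.coe_inv, mul_inv_rev] at hmem
  -- `hmem : t₂y⁻¹ (t₁x⁻¹ (t₁x' t₂y')) ∈ W`; first `x = x'`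
  have hV : (t₁ x)⁻¹ * t₁ x' ∈ V.subgroupOf H := by
    rw [Subgroup.mem_subgroupOf, Subgroup.coe_mul, Subgroup.coe_inv]
    have h1 : ((t₁ x : H) : absoluteGaloisGroup K)⁻¹ * ((t₁ x' : H) : absoluteGaloisGroup K) =
        ((t₂ y : V) : absoluteGaloisGroup K) *
          ((((t₂ y : V) : absoluteGaloisGroup K))⁻¹ * ((((t₁ x : H) : absoluteGaloisGroup K))⁻¹ *
            (((t₁ x' : H) : absoluteGaloisGroup K) * ((t₂ y' : V) : absoluteGaloisGroup K)))) *
            ((t₂ y' : V) : absoluteGaloisGroup K)⁻¹ := by group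
    rw [h1]
    exact V.mul_mem (V.mul_mem (t₂ y).2 (hWV hmem)) (V.inv_mem (t₂ y').2)
  have hx : x = x' := by rw [← ht₁ x, ← ht₁ x']; exact QuotientGroup.eq.mpr hV
  subst hx
  have hW : (t₂ y)⁻¹ * t₂ y' ∈ W.subgroupOf V := by
    rw [Subgroup.mem_subgroupOf, Subgroup.coe_mul, Subgroup.coe_inv]
    simpa only [mul_assoc, inv_mul_cancel_left] using hmem
  have hy : y = y' := by rw [← ht₂ y, ← ht₂ y']; exact QuotientGroup.eq.mpr hW
  rw [hy]

omit [Fintype (H ⧸ V.subgroupOf H)] [Fintype (V ⧸ W.subgroupOf V)] [Fintype (H ⧸ W.subgroupOf H)] in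
/-- … and every class of `H/W` contains such a product. [cite: Serre1979, X §3 b)] -/
theorem surjective_mul_section (hVH : V ≤ H) {t₁ : H ⧸ V.subgroupOf H → H}
    (ht₁ : ∀ x, (t₁ x : H ⧸ V.subgroupOf H) = x) {t₂ : V ⧸ W.subgroupOf V → V} (ht₂ : ∀ y, (t₂ y : V ⧸ W.subgroupOf V) = y) :
    Function.Surjective fun p : (H ⧸ V.subgroupOf H) × (V ⧸ W.subgroupOf V) ↦
      ((t₁ p.1 * ⟨((t₂ p.2 : V) : absoluteGaloisGroup K), hVH (t₂ p.2).2⟩ : H) : H ⧸ W.subgroupOf H) := by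
  intro w
  induction w using QuotientGroup.induction_on with
  | H h =>
    -- `x = hV`, `v = t₁(x)⁻¹ h ∈ V`, `y = vW`
    have hv : (((t₁ (h : H ⧸ V.subgroupOf H) : H) : absoluteGaloisGroup K))⁻¹ * (h : absoluteGaloisGroup K) ∈ V := by
      have hm : (t₁ (h : H ⧸ V.subgroupOf H))⁻¹ * h ∈ V.subgroupOf H := QuotientGroup.eq.mp (ht₁ _)
      rwa [Subgroup.mem_subgroupOf, Subgroup.coe_mul, Subgroup.coe_inv] at hm
    refine ⟨((h : H ⧸ V.subgroupOf H), ((⟨_, hv⟩ : V) : V ⧸ W.subgroupOf V)), QuotientGroup.eq.mpr ?_⟩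
    rw [Subgroup.mem_subgroupOf]
    have hm : (t₂ (((⟨_, hv⟩ : V) : V ⧸ W.subgroupOf V)))⁻¹ * (⟨_, hv⟩ : V) ∈ W.subgroupOf V := QuotientGroup.eq.mp (ht₂ _)
    rw [Subgroup.mem_subgroupOf] at hm
    convert hm using 1
    simp only [Subgroup.coe_mul, Subgroup.coe_inv, mul_inv_rev, mul_assoc]

/-- ★ **TRANSITIVITY `N_{H/V} ∘ N_{V/W} = N_{H/W}`** on `W`-fixed units (`W ≤ V ≤ H`; any sections `t₁, t₂, t₃`): the products
`t₁(x)·t₂(y)`, `x ∈ H/V`, `y ∈ V/W`, represent the classes of `H/W` exactly once.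
[cite: Serre1979, X §3 b)] [cite: NeukirchSchmidtWingberg2008, I §5] -/
theorem prod_smul_prod_smul_eq (hWV : W ≤ V) (hVH : V ≤ H) {t₁ : H ⧸ V.subgroupOf H → H}
    (ht₁ : ∀ x, (t₁ x : H ⧸ V.subgroupOf H) = x) {t₂ : V ⧸ W.subgroupOf V → V} (ht₂ : ∀ y, (t₂ y : V ⧸ W.subgroupOf V) = y)
    {t₃ : H ⧸ W.subgroupOf H → H} (ht₃ : ∀ w, (t₃ w : H ⧸ W.subgroupOf H) = w) {z : (AlgebraicClosure K)ˣ}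
    (hz : ∀ σ : W, (σ : absoluteGaloisGroup K) • z = z) :
    ∏ x, ((t₁ x : H) : absoluteGaloisGroup K) • ∏ y, ((t₂ y : V) : absoluteGaloisGroup K) • z =
      ∏ w, ((t₃ w : H) : absoluteGaloisGroup K) • z := by
  rw [← prod_smul_eq_prod_smul_of_bijective _ ⟨injective_mul_section hWV hVH ht₁ ht₂, surjective_mul_section hVH ht₁ ht₂⟩ ht₃ hz,
    Fintype.prod_prod_type]
  refine Finset.prod_congr rfl fun x _ ↦ ?_
  rw [Finset.smul_prod']
  exact Finset.prod_congr rfl fun y _ ↦ by rw [Subgroup.coe_mul, Subgroup.coe_mk, mul_smul]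

end Transitivity

/-! ## §3 Equivariance under the ambient group (normal subgroups) -/

section Equivariance

variable {V H : Subgroup (absoluteGaloisGroup K)} [H.Normal] [V.Normal] [Fintype (H ⧸ V.subgroupOf H)]

omit [Fintype (H ⧸ V.subgroupOf H)] in
/-- A translate `g·z` of a `V`-fixed unit is `V`-fixed (`V` normal). [cite: Serre1979, VII §5] -/
theorem forall_smul_smul_eq (g : absoluteGaloisGroup K) {z : (AlgebraicClosure K)ˣ}
    (hz : ∀ σ : V, (σ : absoluteGaloisGroup K) • z = z) (σ : V) : (σ : absoluteGaloisGroup K) • g • z = g • z := by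
  have hmem : g⁻¹ * (σ : absoluteGaloisGroup K) * g ∈ V := by
    simpa using Subgroup.Normal.conj_mem inferInstance (σ : absoluteGaloisGroup K) σ.2 g⁻¹
  have h := hz ⟨_, hmem⟩
  change (g⁻¹ * (σ : absoluteGaloisGroup K) * g) • z = z at h
  calc (σ : absoluteGaloisGroup K) • g • z = (g * (g⁻¹ * (σ : absoluteGaloisGroup K) * g)) • z := by
        rw [smul_smul]; congr 1; group
    _ = g • z := by rw [mul_smul, h]

/-- ★ **EQUIVARIANCE `g·N_{H/V}(z) = N_{H/V}(g·z)`** for `g ∈ Γ_K`, `H, V ⊴ Γ_K`, `z` a `V`-fixed unit: the conjugates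
`g t(x) g⁻¹` represent the classes of `H/V` exactly once. [cite: Serre1979, X §3 b) and VII §5] [cite: NeukirchSchmidtWingberg2008, I §5] -/
theorem smul_prod_smul_eq (g : absoluteGaloisGroup K) {t : H ⧸ V.subgroupOf H → H} (ht : ∀ x, (t x : H ⧸ V.subgroupOf H) = x)
    {z : (AlgebraicClosure K)ˣ} (hz : ∀ σ : V, (σ : absoluteGaloisGroup K) • z = z) :
    g • ∏ x, ((t x : H) : absoluteGaloisGroup K) • z = ∏ x, ((t x : H) : absoluteGaloisGroup K) • g • z := by
  -- the conjugated family
  let r : H ⧸ V.subgroupOf H → H := fun x ↦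
    ⟨g * ((t x : H) : absoluteGaloisGroup K) * g⁻¹, Subgroup.Normal.conj_mem inferInstance _ (t x).2 g⟩
  have hr : ∀ x, ((r x : H) : absoluteGaloisGroup K) = g * ((t x : H) : absoluteGaloisGroup K) * g⁻¹ := fun x ↦ rfl
  have hinj : Function.Injective fun x ↦ (r x : H ⧸ V.subgroupOf H) := by
    intro x y hxy
    have hmem : (r x)⁻¹ * r y ∈ V.subgroupOf H := QuotientGroup.eq.mp hxy
    rw [Subgroup.mem_subgroupOf, Subgroup.coe_mul, Subgroup.coe_inv, hr, hr] at hmem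
    have h1 : (g * ((t x : H) : absoluteGaloisGroup K) * g⁻¹)⁻¹ * (g * ((t y : H) : absoluteGaloisGroup K) * g⁻¹) =
        g * ((((t x : H) : absoluteGaloisGroup K))⁻¹ * ((t y : H) : absoluteGaloisGroup K)) * g⁻¹ := by group
    rw [h1] at hmem
    have hV : (t x)⁻¹ * t y ∈ V.subgroupOf H := by
      rw [Subgroup.mem_subgroupOf, Subgroup.coe_mul, Subgroup.coe_inv]
      have h2 := Subgroup.Normal.conj_mem inferInstance _ hmem g⁻¹
      simpa [mul_assoc] using h2
    rw [← ht x, ← ht y]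
    exact QuotientGroup.eq.mpr hV
  have hbij : Function.Bijective fun x ↦ (r x : H ⧸ V.subgroupOf H) := Finite.injective_iff_bijective.mp hinj
  rw [Finset.smul_prod', ← prod_smul_eq_prod_smul_of_bijective r hbij ht (forall_smul_smul_eq g hz)]
  refine Finset.prod_congr rfl fun x _ ↦ ?_
  rw [hr, smul_smul, smul_smul, mul_assoc, inv_mul_cancel, mul_one]

end Equivariance

end Literature.NumberTheory.GaloisRepresentations

end
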